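import Mathlib

/-!
# Markman 2025 — LEMMA 9.3.6, Step 1, last sentence (v2 p. 85 L32–37): «the composition `ρ_ij ρ_jk ρ_ki` is an
# invertible holomorphic function times the identity automorphism, since `g_ij g_jk g_ki` is the identity in `Ḡ` and
# so `λ̄_ij ∘ τ*_{g_ij}(λ̄_jk) ∘ τ*_{g_ik}(λ̄_ki)` is an invertible holomorphic function times the identity automorphism»
# — the group-theoretic mechanism (a linearization read modulo scalars is a crossed homomorphism modulo scalars, so
# its value on a relation `abc = 1` is a scalar), AS PRINTED, kernel-checked

E. Markman: [M] *Cycles on abelian 2n-folds of Weil type from secant sheaves on abelian n-folds*,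
arXiv:2502.03415 **v2** (2025-06-08), bib `Markman2025SecantWeil` — UNREFEREED PREPRINT. «p. N L m» = PyMuPDF line `m`
of page `N` of the public v2 PDF (sha256/16 `8155aa33870069b8`), text layer re-extracted at seat lit-w-markman g21
(pub-hsemireg LIT-W, 2026-08-25; sheet `LOCATOR-SHEET-MARKMAN.md` §2 carries §9.3 verbatim; p. 85 was read by eye at
seat lit-3 g57 for LEAN #35, bus l.20743, and on the render `r_mar25v2_p85_step1.png` of this seat in
`HOME/lit/Markman-renders-litw-markman-g21/`). `TwistedSheafCechCocycles.lean` (LEAN #35) kernel-checks Steps 2–3 of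
LEMMA 9.3.6 (the `μ_r`-normalisation (9.3.2)) and takes «Lemma 9.3.6 Step 1 (the `G^∨`-linearization gluings)» BY
VALUE; this leaf supplies the one group-theoretic step of Step 1 — why the gluings `ρ_ij` built from a linearization
and CHOSEN trivializations close up on triple overlaps only up to an invertible function (rows M-Mk6 ∕ M-Mk4, W1
«twisted sheaves on gerbes»: this is exactly where the twisting 2-cocycle of `𝓑′` is born).

## What is printed (verbatim, v2 p. 85 L6–40, Step 1 of the proof of LEMMA 9.3.6; calligraphic `𝓔`, `𝓑′` as printed)

«Step 1: We first construct a twisted reflexive sheaf `𝓑′` which is locally free over `Y⁰` and such that `ℙ(ι^*𝓑′) ≅ B`.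
Choose a covering `Ū := {Ū_j}_{j∈Ī}` of `Y` … such that if `U_i` is a connected component of `q⁻¹(Ū_ī)` and `U_j` is a
connected component of `q⁻¹(Ū_j̄)` and `Ū_ī ∩ Ū_j̄ ≠ ∅`, then there exists a unique element `g_ij ∈ Ḡ`, such that
`τ_{g_ij}(U_j)` intersects `U_i`. Let `L_ij` be the unique line bundle, such that `(g_ij, L_ij)` is an element of `G^∨`
corresponding to the autoequivalence `L_ij ⊗ τ_{g_ij,*}`. … Let `𝓔_i` be the restriction of `𝓔` to `U_i`. Set
`𝓑′_i := q_{i,*}(𝓔_i)`. If `V_ij ≠ ∅`, let `ρ_ij : 𝓑′_j|_{V_ij} → 𝓑′_i|_{V_ij}` be the composition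
`𝓑′_j|_{V_ij} = q_{j,*}(𝓔_j)|_{V_ij} →^{q_*(λ̄_ij)} q_{j,*}(τ_{g_ji,*}(𝓔_i))|_{V_ij} = q_{i,*}(𝓔_i)|_{V_ij} = 𝓑′_i|_{V_ij}`, where
`λ̄_ij : 𝓔|_{U_j ∩ τ_{g_ji}(U_i)} → (τ_{g_ji,*}𝓔)|_{U_j ∩ τ_{g_ji}(U_i)}` is induced by the isomorphism
`ν_{g_ji} : 𝓔 → (τ_{g_ji,*}𝓔) ⊗ L_ji` of the `G^∨`-linearization of `𝓔` and by a choice of a trivialization of `L_ji` over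
`U_j`. The sheaves `𝓑′_i` are clearly locally free over `V_i ∩ Y⁰`. If `V_ijk := V_i ∩ V_j ∩ V_k` is non-empty, then the
composition `ρ_ij ρ_jk ρ_ki` is an invertible holomorphic function times the identity automorphism, since `g_ij g_jk g_ki`
is the identity in `Ḡ` and so `λ̄_ij ∘ τ*_{g_ij}(λ̄_jk) ∘ τ*_{g_ik}(λ̄_ki)` is an invertible holomorphic function times the
identity automorphism. The twisted sheaf `𝓑′ := {𝓑′_i, ρ_ij}_{i,j∈I}` is locally free over `Y⁰` and the projectivisation of
`ι^*𝓑′` is naturally isomorphic to `B`.»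

## The model and what is proved (0 `def`, 0 named fact, 0 sorry; nothing geometric)

`Γ` = the group `Ḡ` (≅ `G^∨`); `K` = a group standing for the automorphisms in play on a triple overlap (after the
translates of `𝓔` are identified by the `τ_{g,*}`), on which `Γ` acts by group automorphisms (`MulDistribMulAction Γ K`:
`g • k` is the conjugate `τ_g^*(k)`); `Z ≤ K` = the NORMAL subgroup of «invertible holomorphic functions times the
identity automorphism» (scalars; its `Γ`-stability is not even needed for this step). A `G^∨`-LINEARIZATION `ν` (isomorphisms `ν_g : 𝓔 → τ_{g,*}𝓔 ⊗ L_g` satisfying the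
cocycle condition) read through CHOSEN trivializations of the `L_g` gives elements `λ̄_g ∈ K` that satisfy the cocycle
condition only MODULO `Z` — a crossed homomorphism modulo scalars: `λ̄_{gh} ≡ λ̄_g · g•λ̄_h (mod Z)`, `λ̄_1 ∈ Z`
(hypotheses `hcocycle`, `hone`; the passage from `ν` to these hypotheses is BY VALUE — it is what «induced by the
isomorphism `ν_{g_ji}` … and by a choice of a trivialization of `L_ji`» says). PROVED: for `a b c ∈ Γ` with `a·b·c = 1`
(«`g_ij g_jk g_ki` is the identity in `Ḡ`»), `λ̄_a · a•λ̄_b · (ab)•λ̄_c ∈ Z` («`λ̄_ij ∘ τ*_{g_ij}(λ̄_jk) ∘ τ*_{g_ik}(λ̄_ki)` is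
an invertible holomorphic function times the identity», with `g_ik = g_ij g_jk`) — `crossedLift_rel_mem`,
`step1_triple_overlap`; the untwisted special case (trivial action: a map that is a homomorphism modulo `Z` sends
relations to `Z`, `lift_rel_mem`) and the two-term case `λ̄_g · g•λ̄_{g⁻¹} ∈ Z` (`crossedLift_inv_mem`, the `ρ_ij ρ_ji` case)
are included. BY VALUE ∕ NOT formalised: sheaves, coverings, `q_{i,*}`, the existence∕uniqueness of `g_ij`, that
`g_ij g_jk g_ki = 1` (uniqueness of the `g_ij`), `ℙ(ι^*𝓑′) ≅ B`, Steps 2–5 (LEAN #35 has Steps 2–3). Honest framing: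
bookkeeping of a printed elementary step; nothing here says that any object of the pub-hsemireg cell is a twisted
sheaf with any property, or that HC ∕ HC_CM ∕ HC_AV is proved.
-/

namespace Literature.AlgebraicGeometry.Markman2025.Lemma936Step1

variable {Γ K : Type*} [Group Γ] [Group K]

/-! ### §A — untwisted warm-up: a homomorphism modulo `Z` sends relations to `Z` -/

/-- If `s : Γ → K` is a homomorphism MODULO a normal subgroup `Z` (`s(gh) ≡ s(g)s(h)`, `s(1) ∈ Z`), then `a·b·c = 1`
forces `s(a)s(b)s(c) ∈ Z` — the mechanism of «`ρ_ij ρ_jk ρ_ki` is an invertible holomorphic function times the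
identity» when the translation twists are ignored. [cite: Markman2025SecantWeil, Lemma 9.3.6 (proof, Step 1), v2 p. 85 L32–37 (untwisted form of the mechanism)] -/
theorem lift_rel_mem (Z : Subgroup K) [Z.Normal] (s : Γ → K) (hmul : ∀ g h, (s (g * h))⁻¹ * (s g * s h) ∈ Z)
    (hone : s 1 ∈ Z) {a b c : Γ} (habc : a * b * c = 1) : s a * s b * s c ∈ Z := by
  -- pass to the quotient `K ⧸ Z`, where `s` becomes a genuine homomorphism
  rw [← QuotientGroup.eq_one_iff]
  have hq : ∀ g h, (QuotientGroup.mk (s (g * h)) : K ⧸ Z) = QuotientGroup.mk (s g) * QuotientGroup.mk (s h) := by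
    intro g h
    rw [← QuotientGroup.mk_mul, QuotientGroup.eq]
    exact hmul g h
  rw [QuotientGroup.mk_mul, QuotientGroup.mk_mul, ← hq, ← hq, habc, QuotientGroup.eq_one_iff]
  exact hone

/-! ### §B — the printed, twisted form: `λ̄_ij ∘ τ*_{g_ij}(λ̄_jk) ∘ τ*_{g_ik}(λ̄_ki)` -/

section Crossed

variable [MulDistribMulAction Γ K]

/-- A CROSSED homomorphism modulo a normal subgroup `Z` — `λ̄(gh) ≡ λ̄(g)·g•λ̄(h) (mod Z)`, `λ̄(1) ∈ Z` (a
linearization read through chosen trivializations) — sends every relation `a·b·c = 1` of `Γ` to `Z`: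
`λ̄(a) · a•λ̄(b) · (ab)•λ̄(c) ∈ Z`. [cite: Markman2025SecantWeil, Lemma 9.3.6 (proof, Step 1), v2 p. 85 L32–37] -/
theorem crossedLift_rel_mem (Z : Subgroup K) [hZ : Z.Normal]
    (lam : Γ → K) (hcocycle : ∀ g h, (lam (g * h))⁻¹ * (lam g * g • lam h) ∈ Z) (hone : lam 1 ∈ Z)
    {a b c : Γ} (habc : a * b * c = 1) : lam a * a • lam b * (a * b) • lam c ∈ Z := by
  -- `lam a * a•lam b = lam (ab) * z₁` and `lam (ab) * (ab)•lam c = lam (abc) * z₂ = lam 1 * z₂`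
  have h1 : (lam (a * b))⁻¹ * (lam a * a • lam b) ∈ Z := hcocycle a b
  have h2 : (lam (a * b * c))⁻¹ * (lam (a * b) * (a * b) • lam c) ∈ Z := hcocycle (a * b) c
  rw [habc] at h2
  -- rewrite the target as `lam 1 * [(lam 1)⁻¹ (lam(ab) (ab)•lam c)] * [((ab)•lam c)⁻¹ ((lam(ab))⁻¹ (lam a  a•lam b)) ((ab)•lam c)]`
  have key : lam a * a • lam b * (a * b) • lam c =
      lam 1 * ((lam 1)⁻¹ * (lam (a * b) * (a * b) • lam c)) *
        (((a * b) • lam c)⁻¹ * ((lam (a * b))⁻¹ * (lam a * a • lam b)) * ((a * b) • lam c)) := by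
    group
  rw [key]
  refine Z.mul_mem (Z.mul_mem hone h2) ?_
  -- a conjugate of an element of `Z` lies in `Z`
  have := hZ.conj_mem _ h1 (((a * b) • lam c)⁻¹)
  simpa only [inv_inv] using this

/-- The two-term case: `λ̄(g) · g•λ̄(g⁻¹) ∈ Z` (the composite `ρ_ij ρ_ji` is an invertible function times the identity).
[cite: Markman2025SecantWeil, Lemma 9.3.6 (proof, Step 1), v2 p. 85 L32–37] -/
theorem crossedLift_inv_mem (Z : Subgroup K) [Z.Normal]
    (lam : Γ → K) (hcocycle : ∀ g h, (lam (g * h))⁻¹ * (lam g * g • lam h) ∈ Z) (hone : lam 1 ∈ Z) (g : Γ) :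
    lam g * g • lam g⁻¹ ∈ Z := by
  have h := crossedLift_rel_mem Z lam hcocycle hone (a := g) (b := g⁻¹) (c := 1) (by group)
  rw [mul_inv_cancel, one_smul] at h
  exact (Z.mul_mem_cancel_right hone).mp h

/-- **LEMMA 9.3.6, Step 1, last sentence**: with `a = g_ij`, `b = g_jk`, `c = g_ki`, «`g_ij g_jk g_ki` is the identity in
`Ḡ`» (hypothesis `hrel`, BY VALUE from the uniqueness of the `g_ij`) and `g_ik = g_ij g_jk`, the composite
`λ̄_ij ∘ τ*_{g_ij}(λ̄_jk) ∘ τ*_{g_ik}(λ̄_ki)` — in the model `λ̄(g_ij) · g_ij•λ̄(g_jk) · (g_ij g_jk)•λ̄(g_ki)` — lies in the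
scalar subgroup `Z`: the gluings `ρ_ij = q_*(λ̄_ij)` form a TWISTED sheaf.
[cite: Markman2025SecantWeil, Lemma 9.3.6 (proof, Step 1), v2 p. 85 L32–40] -/
theorem step1_triple_overlap (Z : Subgroup K) [Z.Normal]
    (lam : Γ → K) (hcocycle : ∀ g h, (lam (g * h))⁻¹ * (lam g * g • lam h) ∈ Z) (hone : lam 1 ∈ Z)
    (gij gjk gki : Γ) (hrel : gij * gjk * gki = 1) :
    lam gij * gij • lam gjk * (gij * gjk) • lam gki ∈ Z :=
  crossedLift_rel_mem Z lam hcocycle hone hrel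

/-- Sanity: a GENUINE crossed homomorphism (`λ̄(gh) = λ̄(g)·g•λ̄(h)`, `λ̄(1) = 1` — a linearization with COMPATIBLE
trivializations) closes up exactly: `λ̄(a)·a•λ̄(b)·(ab)•λ̄(c) = 1` when `abc = 1` (the untwisted gluing of an honest sheaf;
`Z = ⊥`). [cite: Markman2025SecantWeil, Lemma 9.3.6 (proof, Step 1), v2 p. 85 L32–37 (degenerate case `Z` trivial)] -/
theorem crossedHom_rel_eq_one (lam : Γ → K) (hcocycle : ∀ g h, lam (g * h) = lam g * g • lam h) (hone : lam 1 = 1)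
    {a b c : Γ} (habc : a * b * c = 1) : lam a * a • lam b * (a * b) • lam c = 1 := by
  rw [← hcocycle, ← hcocycle, habc, hone]

end Crossed

end Literature.AlgebraicGeometry.Markman2025.Lemma936Step1
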